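import Summits.QuantumFields.YangMills.Theorems.BalabanUVNodesK0AxJoinTD9
import Summits.QuantumFields.YangMills.Theorems.BalabanUVNodesK0AxJoinTGeomB
import Summits.QuantumFields.YangMills.Theorems.BalabanUVNodesPortU8ImagesPackage
import Summits.QuantumFields.YangMills.Theorems.BalabanUVNodesPortU8LocReceipts

/-!
# NODE O · K0ᴬ — ★★★ `twoVolExp_LocUniv_images`: ✓`twoVolExp_LocUniv_of_cmp` (§4 v1.1 of the (R-a) file) WITH THE DISPLAYED (Tok-cmpU-cap) HYPOTHESIS REMOVED —
# [E] from ⁸'s mould + the chart rows alone, the D9 row now supplied by ★★★ PTB-1's token-free ✓`PortU8.portPieceLocalityU8_LocUniv_images` (method of images)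

Cell `ym-nodeO-ideate` ∕ `ym-balaban-port`, porter `ymgap-nodeO-port-PTB-1` (gen 5).  JOIN-side helper for **stmt-QuantumFields-27238** (K0ᴬ), `--supports … --as helper` (NO `--workitem`).
This file is ✓`…K0AxJoinTD9Cmp.lean` (authorship ◇ lens-1 g10, landed ▶ PTC-1 g4, ◆ CRIT-1 g36 (Q-ord) stamp nodeO STATUS 2026-08-31T09:38:02Z) VERBATIM except: the hypothesis
`TokCmpUCap F Mc a₀ →` is DELETED from the signature and the D9 package is taken from ✓`PortU8.portPieceLocalityU8_LocUniv_images F Mc a₀ hMc α₂ hα₂` (g5 Images files 1–5: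
both volumes' whole-torus localized responses are periodisations of ONE infinite-lattice kernel [B5] (1.63); their NEAR difference is two lattice tails; the ‴-clauses are the proved
g4∕g5 clause files) instead of ✓`PortU8.portPieceLocalityU8_LocUniv_of_cmp … hcmp …`.  Signature otherwise byte-identical ((Q-ord): `∃ C₉ δ₀` BEFORE `∀ ιC`, unchanged).
§2 (appended) ★★★ `twoVolExp_LocUniv_images_atLocξ` — the same at `ιC := recordEmbLocξ … Finset.univ` (the localized chart): PART B's `C²`∕zero∕link rows are the PROVED receipts
✓`PortU8.iotaRowAtLocξ_holds` ∕ ✓`PortU8.responseRowAtLocξ_holds`, so the displayed inputs shrink to D1 (⁸'s mould) + ONE swap row (localized chart ~ record chart `recordEmbJ` by a gauge, near 0, per domain).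
§3 ★ CAVEAT ON §2 (porter, same day, BEFORE any booking): the swap row that §2 displays — «for `B` near `0` and every domain `X` the chart of `recordEmbLocξ … univ B` = a gauge transform of
the record chart `recordEmbJ … B` on `X`'s coordinates» — asks an EXACT germ identity between `exp(A′_B)` (the exponential of the LINEAR localized representation `recordALocξ`, ed.16c) and
the record's constrained minimiser `U_{k+1}(W_B)`; for SU(2) this is NOT expected to be inhabitable beyond linear order in `B` (the minimiser carries non-gauge `O(B²)` corrections from the
cubic Yang–Mills vertex; only its DERIVATIVE at `0` is the localized response, [15] (176)–(178) + [B6] (2.35)).  So §2 is an IMPLICATION-ONLY ∕ LINEAR-ORDER PLACEHOLDER and must NOT be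
booked as a reduction of PART B; the consumable theorem of this file is §1 ★★★`twoVolExp_LocUniv_images` (general chart family `ιC` + link row), whose intended instance is the Landau-dressed
record chart of road (R-b) (◇ lens-1 g10), NOT `recordEmbLocξ`.  Nothing else changes.

HONEST (porter): still a CONDITIONAL theorem over DISPLAYED rows — D1 = ⟨27930⟩'s ⁸ consequent `FormatPlusG …` (OPEN), the swap ∕ `C²` ∕ zero ∕ link rows of ONE chart family `ιC`
(PART B, OPEN); what is NO LONGER displayed is (Tok-cmpU-cap).  [E] inhabited unconditionally NOWHERE; K0ᴬ 27238 OPEN; 27931 CLOSED·IMPLICATION-ONLY·IN TOTO unchanged; NODE O 0∕1;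
COUNT 8∕28 · K 1∕4 UNMOVED; finite `𝕋⁴_{L^K}` at fixed ε — NOT continuum ∕ OS ∕ Clay; **the Yang–Mills mass gap (Clay) is NOT proved by any of this.**
-/

noncomputable section

open Filter Topology
open scoped BigOperators Matrix.Norms.L2Operator

namespace Summit.QuantumFields.YangMills.Theorems.K0AxJoinT

open Literature.MathematicalPhysics.QuantumFieldTheory.Balaban1983to89
open Literature.MathematicalPhysics.QuantumFieldTheory.Balaban1983to89.Node00 (betaOfRecord₁₃Ax Stage13Params)
open Literature.MathematicalPhysics.QuantumFieldTheory.Balaban1983to89.T4Continuum (T4Family)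
open Literature.MathematicalPhysics.QuantumFieldTheory.Balaban1983to89.B12FormatPlus
open Summit.QuantumFields.YangMills.Theorems.K0RecordFormatNames
open Summit.QuantumFields.YangMills.Theorems.K0AxTwoVolumeRate (RecordPvolTwoVolExpOnRunsAx)
open Summit.QuantumFields.YangMills.Theorems.K0AxJoinTGeomA (rowG0 rowG3a rowG3b rowG4 cR_record)
open Summit.QuantumFields.YangMills.Theorems.K0AxJoinTGeomB (rowG1_at_recordChoice rowG2_at_recordChoice)
open Summit.QuantumFields.YangMills.Theorems.PortHRecordRowG (rowCubeSumLeaf_at' rowW_treeLeaves_at)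
open Summit.QuantumFields.YangMills.Theorems.PortHRecordJoin (kappa₀_std_pos)
open Literature.MathematicalPhysics.QuantumFieldTheory.Balaban1983to89.FlowStep
open Literature.MathematicalPhysics.QuantumFieldTheory.Balaban1983to89.FlowStepRuns

/-- ★★★ **`twoVolExp_LocUniv_images` — [E] FROM ⁸'s MOULD + THE THREE CHART ROWS ALONE; D9 (token-free, by the method of images), LEAVES AND GEOMETRY DISCHARGED.**
For `0 ≤ E₀`, `κ ≥ 4κ₀(64, 8)`, `0 < Mg`, `0 ≤ c₁`; every `F a₀ ε₂₉ γ₀ α₀ α₁` with `0 < ε₂₉`, `0 < α₀`, `0 < α₁`; every admissible letter `McGuard F Mc` with `Mc ≤ Mg` (NO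
(Tok-cmpU-cap)): THERE ARE `C₉ ≥ 0`, `δ₀ > 0` (★★★ PTB-1's token-free package ✓`portPieceLocalityU8_LocUniv_images` at `α₂ := min ¼ (min α₁ (α₀∕36))`) such that for EVERY chart family `ιC`, D1 + the swap
row + the `C²`∕zero∕link rows of `ιC` against `recordGkLocWξ … univ` give [E] `RecordPvolTwoVolExpOnRunsAx F a₀ ε₂₉ γ₀ E (δ₁∕16)` with `δ₁ = delta1 δ₀ κ Mg`,
`E = 48E₀C₉²K₀K₁ + 32E₀C₉²e^{δ₁Mg c₁}K₀K₁`, `K₀ = B12TreeDecay.K₀ 64 8`, `K₁ = (2(1 − e^{−δ₀∕4})⁻¹)⁴` — all inside the ∃.  CONDITIONAL; nothing of Bałaban asserted; K0ᴬ OPEN;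
the Yang–Mills mass gap is NOT proved.
[cite: Balaban1987RG1, Thm 1 p.259, (0.20) p.256, (1.7) p.261, (1.18)–(1.22) pp.263–264, (4.4)–(4.5) pp.281–282, (4.35)–(4.37) pp.290–291, (5.10) p.293; Balaban1985Variational, Prop. 9 p.309, (190) p.308; Balaban1984PropagatorsII, (2.35) p.228, (2.130) p.246] -/
theorem twoVolExp_LocUniv_images {E₀ κ Mg c₁ : ℝ}
    (hE₀ : 0 ≤ E₀) (hκ : 4 * B12TreeDecay.kappa₀ (4 * 2 ^ 4) (2 * 4) ≤ κ) (hMg : 0 < Mg) (hc₁ : 0 ≤ c₁) :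
    ∀ (F : T4Family) (a₀ ε₂₉ γ₀ α₀ α₁ : ℝ), 0 < ε₂₉ → 0 < α₀ → 0 < α₁ → ∀ Mc : ℕ, McGuard F Mc → (Mc : ℝ) ≤ Mg →
      ∃ C₉ δ₀ : ℝ, 0 ≤ C₉ ∧ 0 < δ₀ ∧
      letI θ := thetaFill F a₀ ε₂₉; letI := θ.instVβ₁; letI := θ.instVβ₂; letI := θ.instιβ
      ∀ (ιC : (k n : ℕ) → recordW F a₀ ε₂₉ k (recordK₀ F Mc k + n) → (Fin (recordChartDimJ F (recordK₀ F Mc k + n)) → ℂ)),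
      (∀ (k : ℕ) (g : ℕ → ℝ), FlowStep.RGEqH k (betaOfRecord₁₃Ax F 2 (thetaFill F a₀ ε₂₉)) g → Step.InInterval γ₀ k g →
        B12FormatPlus.FormatPlusG (fun n => recordDomSys F Mc k (recordK₀ F Mc k + n)) (fun n => recordBondCount F (recordK₀ F Mc k + n))
          (fun n => recordAct F (recordK₀ F Mc k + n)) (fun n => recordUc F Mc k α₀ α₁ (recordK₀ F Mc k + n))
          (fun n => recordCoords F Mc k (recordK₀ F Mc k + n)) (fun n => recordChartDimJ F (recordK₀ F Mc k + n))
          (fun n => recordChartJ F Mc k (recordK₀ F Mc k + n)) (fun n => recordΦfAx F a₀ ε₂₉ k (FlowStep.prefixOf g k) (recordK₀ F Mc k + n))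
          (fun n => recordEmbJ F θ k (recordK₀ F Mc k + n)) (fun n => recordWrapCtr F Mc k (recordK₀ F Mc k + n))
          (fun n => recordDomEmbCtr F Mc k (recordK₀ F Mc k + n)) (fun n _ => recordCoordProjCtr F (recordK₀ F Mc k + n)) E₀ κ) →
      (∀ (k n : ℕ), ∀ᶠ B in 𝓝 (0 : recordW F a₀ ε₂₉ k (recordK₀ F Mc k + n)), ∀ X : (recordDomSys F Mc k (recordK₀ F Mc k + n)).Dom,
          ∃ g : recordGaugeGrp F (recordK₀ F Mc k + n), ∀ i ∈ recordCoords F Mc k (recordK₀ F Mc k + n) X,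
            recordChartJ F Mc k (recordK₀ F Mc k + n) X (ιC k n B) i =
              recordAct F (recordK₀ F Mc k + n) g (recordChartJ F Mc k (recordK₀ F Mc k + n) X (recordEmbJ F θ k (recordK₀ F Mc k + n) B)) i) →
      (∀ k : ℕ, (∀ n : ℕ, ContDiffAt ℝ 2 (ιC k n) 0 ∧ ιC k n 0 = 0) ∧
          ∀ (n : ℕ) (a : θ.ιβ) (l : RespLabel F k (recordK₀ F Mc k + n)),
            recordGkLocWξ F θ k (recordK₀ F Mc k + n) Finset.univ a l = fun i => fderiv ℝ (ιC k n) 0 (Pi.single l.1 (Pi.single l.2 (θ.bV a))) i) →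
      RecordPvolTwoVolExpOnRunsAx F a₀ ε₂₉ γ₀
        (48 * E₀ * C₉ ^ 2 * B12TreeDecay.K₀ (4 * 2 ^ 4) (2 * 4) * (2 * (1 - Real.exp (-(δ₀ / 4)))⁻¹) ^ 4 +
          32 * E₀ * C₉ ^ 2 * Real.exp (B12Decay510.delta1 δ₀ κ Mg * Mg * c₁) * B12TreeDecay.K₀ (4 * 2 ^ 4) (2 * 4) * (2 * (1 - Real.exp (-(δ₀ / 4)))⁻¹) ^ 4)
        (B12Decay510.delta1 δ₀ κ Mg * (1 / 16)) := by
  intro F a₀ ε₂₉ γ₀ α₀ α₁ hε hα₀ hα₁ Mc hMc hMgMc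
  have hα₂ : 0 < min (1 / 4 : ℝ) (min α₁ (α₀ / 36)) := lt_min (by norm_num) (lt_min hα₁ (by positivity))
  obtain ⟨C₉, δ₀, hC₉, hδ₀, hpk⟩ := PortU8.portPieceLocalityU8_LocUniv_images F Mc a₀ hMc (min (1 / 4 : ℝ) (min α₁ (α₀ / 36))) hα₂
  refine ⟨C₉, δ₀, hC₉, hδ₀, fun ιC h8 hsw h9 => ?_⟩
  have hκ0 : 0 < κ := by linarith [kappa₀_std_pos]
  have hK₀ : 0 ≤ B12TreeDecay.K₀ (4 * 2 ^ 4) (2 * 4) := (B12TreeDecay.K₀_pos _ _).le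
  have hδ4 : 0 < δ₀ / 4 := by positivity
  -- the leaves at `δ₀∕4` (cube sums) and `κ∕4` (trees), from the catalogue guard
  have hleaf : ∀ k n : ℕ, B12Decay510.CubeSumLeaf (recordSiteGeom F Mc k (recordK₀ F Mc k + n)) (δ₀ / 4) ((2 * (1 - Real.exp (-(δ₀ / 4)))⁻¹) ^ 4) ∧
      B12Decay510.TreeLeaf (recordCc F Mc k (recordK₀ F Mc k + n)) (κ / 4) (B12TreeDecay.K₀ (4 * 2 ^ 4) (2 * 4)) := by
    intro k n
    refine ⟨rowCubeSumLeaf_at' hMc k _ hδ4, ?_⟩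
    rw [show κ / 4 = κ / 2 / 2 by ring]
    exact (rowW_treeLeaves_at hMc hκ n).2.2
  exact kstep_joinT_at_record_LocUniv (K₀' := B12TreeDecay.K₀ (4 * 2 ^ 4) (2 * 4)) (K₁ := (2 * (1 - Real.exp (-(δ₀ / 4)))⁻¹) ^ 4)
    hE₀ hκ0 hC₉ hδ₀ hMg hK₀ F a₀ ε₂₉ γ₀ α₀ α₁ hα₀ hα₁ Mc
    (fun k n => recordRNat F Mc k (recordK₀ F Mc k + n)) (fun k n => recordR F Mc k (recordK₀ F Mc k + n) / 2 - 2 * (Mc : ℝ)) (1 / 16)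
    cR_record.1 cR_record.2 ιC h8 hsw (fun k => ⟨fun a => (hpk k ε₂₉ hε).1 a, (h9 k).1, (h9 k).2⟩)
    (rowG0 F Mc) (rowG1_at_recordChoice F hMc hMgMc hc₁) (rowG2_at_recordChoice F hMc hMgMc hc₁) (rowG3a F Mc) (rowG3b hMc) (rowG4 hMc) hleaf

/-- ★★★ **`twoVolExp_LocUniv_images_atLocξ` — [E] FROM ⁸'s MOULD + ONE SWAP ROW.**  ✓`twoVolExp_LocUniv_images` at the chart family `ιC k n := recordEmbLocξ F θ k (K₀+n) Finset.univ`
(the chart-unit LOCALIZED chart): its `C²`∕zero rows are ✓`PortU8.iotaRowAtLocξ_holds` and its link row is ✓`PortU8.responseRowAtLocξ_holds` (g3∕g4 receipts, hypothesis-free), so of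
PART B only the SWAP row remains displayed — «near `B = 0`, on the coordinates of every domain `X`, the localized chart is a gauge transform of the record chart `recordEmbJ`».
Displayed inputs now: D1 = ⟨27930⟩'s ⁸ consequent (`h8`) and that one swap row (`hsw`); (Tok-cmpU-cap), the ‴-clauses, the `C²`∕zero∕link rows, the leaves and the geometry are all
PROVED.  CONDITIONAL; [E] inhabited unconditionally NOWHERE; K0ᴬ OPEN; the Yang–Mills mass gap is NOT proved.
[cite: Balaban1987RG1, Thm 1 p.259, (1.18)–(1.22) pp.263–264, (4.4)–(4.5) pp.281–282, (4.35)–(4.37) pp.290–291; Balaban1985Variational, Prop. 9 p.309, (190) p.308; Balaban1984PropagatorsI, (1.63) p.28, p.36 ll.20–23] -/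
theorem twoVolExp_LocUniv_images_atLocξ {E₀ κ Mg c₁ : ℝ}
    (hE₀ : 0 ≤ E₀) (hκ : 4 * B12TreeDecay.kappa₀ (4 * 2 ^ 4) (2 * 4) ≤ κ) (hMg : 0 < Mg) (hc₁ : 0 ≤ c₁) :
    ∀ (F : T4Family) (a₀ ε₂₉ γ₀ α₀ α₁ : ℝ), 0 < ε₂₉ → 0 < α₀ → 0 < α₁ → ∀ Mc : ℕ, McGuard F Mc → (Mc : ℝ) ≤ Mg →
      ∃ C₉ δ₀ : ℝ, 0 ≤ C₉ ∧ 0 < δ₀ ∧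
      letI θ := thetaFill F a₀ ε₂₉; letI := θ.instVβ₁; letI := θ.instVβ₂; letI := θ.instιβ
      (∀ (k : ℕ) (g : ℕ → ℝ), FlowStep.RGEqH k (betaOfRecord₁₃Ax F 2 (thetaFill F a₀ ε₂₉)) g → Step.InInterval γ₀ k g →
        B12FormatPlus.FormatPlusG (fun n => recordDomSys F Mc k (recordK₀ F Mc k + n)) (fun n => recordBondCount F (recordK₀ F Mc k + n))
          (fun n => recordAct F (recordK₀ F Mc k + n)) (fun n => recordUc F Mc k α₀ α₁ (recordK₀ F Mc k + n))
          (fun n => recordCoords F Mc k (recordK₀ F Mc k + n)) (fun n => recordChartDimJ F (recordK₀ F Mc k + n))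
          (fun n => recordChartJ F Mc k (recordK₀ F Mc k + n)) (fun n => recordΦfAx F a₀ ε₂₉ k (FlowStep.prefixOf g k) (recordK₀ F Mc k + n))
          (fun n => recordEmbJ F θ k (recordK₀ F Mc k + n)) (fun n => recordWrapCtr F Mc k (recordK₀ F Mc k + n))
          (fun n => recordDomEmbCtr F Mc k (recordK₀ F Mc k + n)) (fun n _ => recordCoordProjCtr F (recordK₀ F Mc k + n)) E₀ κ) →
      (∀ (k n : ℕ), ∀ᶠ B in 𝓝 (0 : recordW F a₀ ε₂₉ k (recordK₀ F Mc k + n)), ∀ X : (recordDomSys F Mc k (recordK₀ F Mc k + n)).Dom,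
          ∃ g : recordGaugeGrp F (recordK₀ F Mc k + n), ∀ i ∈ recordCoords F Mc k (recordK₀ F Mc k + n) X,
            recordChartJ F Mc k (recordK₀ F Mc k + n) X (recordEmbLocξ F θ k (recordK₀ F Mc k + n) Finset.univ B) i =
              recordAct F (recordK₀ F Mc k + n) g (recordChartJ F Mc k (recordK₀ F Mc k + n) X (recordEmbJ F θ k (recordK₀ F Mc k + n) B)) i) →
      RecordPvolTwoVolExpOnRunsAx F a₀ ε₂₉ γ₀
        (48 * E₀ * C₉ ^ 2 * B12TreeDecay.K₀ (4 * 2 ^ 4) (2 * 4) * (2 * (1 - Real.exp (-(δ₀ / 4)))⁻¹) ^ 4 +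
          32 * E₀ * C₉ ^ 2 * Real.exp (B12Decay510.delta1 δ₀ κ Mg * Mg * c₁) * B12TreeDecay.K₀ (4 * 2 ^ 4) (2 * 4) * (2 * (1 - Real.exp (-(δ₀ / 4)))⁻¹) ^ 4)
        (B12Decay510.delta1 δ₀ κ Mg * (1 / 16)) := by
  intro F a₀ ε₂₉ γ₀ α₀ α₁ hε hα₀ hα₁ Mc hMc hMgMc
  obtain ⟨C₉, δ₀, hC₉, hδ₀, h⟩ := twoVolExp_LocUniv_images hE₀ hκ hMg hc₁ F a₀ ε₂₉ γ₀ α₀ α₁ hε hα₀ hα₁ Mc hMc hMgMc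
  refine ⟨C₉, δ₀, hC₉, hδ₀, fun h8 hsw => h (fun k n => recordEmbLocξ F (thetaFill F a₀ ε₂₉) k (recordK₀ F Mc k + n) Finset.univ) h8 hsw fun k => ⟨fun n => ?_, fun n a l => ?_⟩⟩
  · exact PortU8.iotaRowAtLocξ_holds F a₀ ε₂₉ k (recordK₀ F Mc k + n) Finset.univ
  · funext i
    exact (PortU8.responseRowAtLocξ_holds F a₀ ε₂₉ k (recordK₀ F Mc k + n) Finset.univ a l i).symm


/-! ## §3  CAVEAT on §2 — read before booking

`twoVolExp_LocUniv_images_atLocξ` (§2) is a correct kernel implication whose displayed swap-row hypothesis, AT THE INSTANCE `ιC := recordEmbLocξ … Finset.univ`, is FALSE-SHAPED beyond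
linear order in `B` (exact gauge equivalence of `exp(linear response)` with the nonlinear minimiser chart `recordEmbJ`); it is kept as a linear-order placeholder only.  The theorem to
consume is §1 `twoVolExp_LocUniv_images`: [E] from D1 + the swap ∕ `C²` ∕ zero ∕ link rows of a GENERAL chart family `ιC` (intended: the Landau-dressed record chart), with
(Tok-cmpU-cap) no longer displayed. -/

end Summit.QuantumFields.YangMills.Theorems.K0AxJoinT

end
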